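import Mathlib.Analysis.Calculus.BumpFunction.Basic
import Mathlib.Analysis.Calculus.BumpFunction.InnerProduct
import Mathlib.Analysis.Calculus.ContDiff.Bounds
import HarnessLib

/-!
# Localisation away from a point: replacing a field by a constant inside a ball, with bounds on
# all derivatives (theorems only)

Analysis/FunctionSpaces support file (everything proved; no definitions, no named facts),
companion of `TorusPeriodicLocalization.lean`. Given a smooth field `f` on a real normed space,
a constant `c` and a bump `χ` centred at `x₀` (`= 1` on `‖y − x₀‖ ≤ r_in`, supported in
`‖y − x₀‖ < r_out`), the field

  `y ↦ c + (1 − χ y) • (f y − c)`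

is smooth (`contDiff_fill`), equals `f` off the ball `‖y − x₀‖ < r_out` and `c` on
`‖y − x₀‖ ≤ r_in` (`fill_eq_of_le_dist`, `fill_eq_const`), lies between `f` and `c` for real
fields (`le_fill`, `fill_le`), and ALL its derivatives of order `n` are bounded by
`(1 + 2ⁿB_χ) A` whenever `‖∇ʲ(f − c)(y)‖ ≤ A` for `j ≤ n` on the EXTERIOR region `r_in ≤ ‖y − x₀‖`
(`norm_iteratedFDeriv_fill_le`) — the interior, where `f` may be wild (e.g. the core of a
self-similar blow-up profile), does not enter. This is the "smooth filler" of the auxiliary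
problem in gluing constructions by finite speed of propagation
([cite: CaolaboraEtAl2025, Rem. 1.5 p. 7]). [folklore]
-/

noncomputable section

open Set Function Filter Topology Metric
open scoped ContDiff

namespace Literature.Analysis.FunctionSpaces

variable {E : Type*} [NormedAddCommGroup E] [InnerProductSpace ℝ E] [FiniteDimensional ℝ E]
variable {F : Type*} [NormedAddCommGroup F] [NormedSpace ℝ F]

section Fill

variable {x₀ : E} (χ : ContDiffBump x₀) (f : E → F) (c : F)

omit [FiniteDimensional ℝ E] in
/-- Smoothness of the filled field. [folklore] -/
theorem contDiff_fill {n : ℕ∞} (hf : ContDiff ℝ n f) :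
    ContDiff ℝ n fun y => c + (1 - χ y) • (f y - c) :=
  contDiff_const.add ((contDiff_const.sub (χ.contDiff (n := n))).smul (hf.sub contDiff_const))

omit [FiniteDimensional ℝ E] in
/-- Off the ball `‖y − x₀‖ < r_out` the filled field is `f`. [folklore] -/
theorem fill_eq_of_le_dist {y : E} (hy : χ.rOut ≤ dist y x₀) :
    c + (1 - χ y) • (f y - c) = f y := by
  rw [χ.zero_of_le_dist hy, sub_zero, one_smul, add_sub_cancel]

omit [FiniteDimensional ℝ E] in
/-- On `‖y − x₀‖ ≤ r_in` the filled field is the constant `c`. [folklore] -/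
theorem fill_eq_const {y : E} (hy : y ∈ closedBall x₀ χ.rIn) :
    c + (1 - χ y) • (f y - c) = c := by
  rw [χ.one_of_mem_closedBall hy, sub_self, zero_smul, add_zero]

omit [FiniteDimensional ℝ E] in
/-- Order, lower: `m ≤ f`, `m ≤ c` imply `m ≤` the filled (real) field. [folklore] -/
theorem le_fill {f : E → ℝ} {c m : ℝ} (hf : ∀ y, m ≤ f y) (hc : m ≤ c) (y : E) :
    m ≤ c + (1 - χ y) • (f y - c) := by
  rw [smul_eq_mul]
  have h0 := χ.nonneg' y
  have h1 := χ.le_one (x := y)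
  nlinarith [hf y]

omit [FiniteDimensional ℝ E] in
/-- Order, upper: `f ≤ M`, `c ≤ M` imply the filled (real) field is `≤ M`. [folklore] -/
theorem fill_le {f : E → ℝ} {c M : ℝ} (hf : ∀ y, f y ≤ M) (hc : c ≤ M) (y : E) :
    c + (1 - χ y) • (f y - c) ≤ M := by
  rw [smul_eq_mul]
  have h0 := χ.nonneg' y
  have h1 := χ.le_one (x := y)
  nlinarith [hf y]

/-- Uniform bounds for the derivatives of `1 − χ` up to a given order. [folklore] -/
theorem exists_bound_iteratedFDeriv_one_sub_bump (n : ℕ) :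
    ∃ B : ℝ, 0 ≤ B ∧ ∀ i, i ≤ n → ∀ y, ‖iteratedFDeriv ℝ i (fun y => 1 - χ y) y‖ ≤ B := by
  induction n with
  | zero =>
    refine ⟨1, zero_le_one, fun i hi y => ?_⟩
    obtain rfl : i = 0 := Nat.le_zero.1 hi
    rw [norm_iteratedFDeriv_zero, Real.norm_eq_abs, abs_le]
    have h0 := χ.nonneg' y
    have h1 := χ.le_one (x := y)
    constructor <;> linarith
  | succ n ih =>
    obtain ⟨B, hB0, hB⟩ := ih
    -- `∇^{n+1}(1 − χ) = −∇^{n+1}χ`, bounded (compact support, continuity)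
    obtain ⟨C, hC⟩ := (χ.hasCompactSupport.iteratedFDeriv (𝕜 := ℝ) (n + 1)).exists_bound_of_continuous
      (χ.contDiff.continuous_iteratedFDeriv' (m := n + 1))
    have hχs : ContDiff ℝ (n + 1 : ℕ) fun y => χ y := χ.contDiff
    have hneg : ∀ y, iteratedFDeriv ℝ (n + 1) (fun y => 1 - χ y) y =
        -iteratedFDeriv ℝ (n + 1) (fun y => χ y) y := by
      intro y
      have h1 : (fun y => 1 - χ y) = (fun _ => (1 : ℝ)) + fun y => -χ y := by
        funext z; simp [sub_eq_add_neg]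
      rw [h1, iteratedFDeriv_add_apply contDiff_const.contDiffAt (hχs.neg.contDiffAt)]
      rw [iteratedFDeriv_const_of_ne (by simp) (1 : ℝ), Pi.zero_apply, zero_add]
      have h2 : (fun y => -χ y) = -fun y => χ y := rfl
      rw [h2, iteratedFDeriv_neg_apply]
    refine ⟨max B C, le_max_of_le_left hB0, fun i hi y => ?_⟩
    rcases Nat.lt_or_eq_of_le hi with h | rfl
    · exact (hB i (Nat.lt_succ_iff.1 h) y).trans (le_max_left _ _)
    · rw [hneg y, norm_neg]
      exact (hC y).trans (le_max_right _ _)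

omit [FiniteDimensional ℝ E] in
/-- **All derivatives of the filled field are controlled by those of `f − c` on the exterior
region `r_in ≤ ‖y − x₀‖`.** If `‖∇ʲ(f − c)(y)‖ ≤ A` for all `j ≤ n` and all `y` with
`r_in ≤ dist y x₀`, then `‖∇ⁿ[(1 − χ) • (f − c)](y)‖ ≤ 2ⁿ B_χ A` for every `y`
(inside `‖y − x₀‖ < r_in` the field vanishes identically). [folklore] -/
theorem norm_iteratedFDeriv_one_sub_bump_smul_le {n : ℕ} {B : ℝ} (hB0 : 0 ≤ B)
    (hB : ∀ i, i ≤ n → ∀ y, ‖iteratedFDeriv ℝ i (fun y => 1 - χ y) y‖ ≤ B)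
    (hf : ContDiff ℝ ∞ f) {A : ℝ} (hA0 : 0 ≤ A)
    (hA : ∀ j, j ≤ n → ∀ y, χ.rIn ≤ dist y x₀ → ‖iteratedFDeriv ℝ j (fun y => f y - c) y‖ ≤ A)
    (y : E) :
    ‖iteratedFDeriv ℝ n (fun y => (1 - χ y) • (f y - c)) y‖ ≤ 2 ^ n * B * A := by
  by_cases hy : χ.rIn ≤ dist y x₀
  · have hfc : ContDiff ℝ ∞ fun y => f y - c := hf.sub contDiff_const
    have h1χ : ContDiff ℝ ∞ fun y => 1 - χ y := contDiff_const.sub χ.contDiff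
    have h := norm_iteratedFDeriv_smul_le (𝕜 := ℝ) h1χ hfc y (n := n) (by exact_mod_cast le_top)
    refine h.trans ?_
    calc ∑ i ∈ Finset.range (n + 1), (n.choose i : ℝ) * ‖iteratedFDeriv ℝ i (fun y => 1 - χ y) y‖ *
          ‖iteratedFDeriv ℝ (n - i) (fun y => f y - c) y‖
        ≤ ∑ i ∈ Finset.range (n + 1), (n.choose i : ℝ) * B * A := by
          refine Finset.sum_le_sum fun i hi => ?_
          have hin : i ≤ n := Nat.lt_succ_iff.1 (Finset.mem_range.1 hi)
          have h1 := hB i hin y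
          have h2 := hA (n - i) (Nat.sub_le n i) y hy
          have h3 : ‖iteratedFDeriv ℝ i (fun y => 1 - χ y) y‖ *
              ‖iteratedFDeriv ℝ (n - i) (fun y => f y - c) y‖ ≤ B * A :=
            mul_le_mul h1 h2 (norm_nonneg _) hB0
          calc (n.choose i : ℝ) * ‖iteratedFDeriv ℝ i (fun y => 1 - χ y) y‖ *
                ‖iteratedFDeriv ℝ (n - i) (fun y => f y - c) y‖
              = (n.choose i : ℝ) * (‖iteratedFDeriv ℝ i (fun y => 1 - χ y) y‖ *
                  ‖iteratedFDeriv ℝ (n - i) (fun y => f y - c) y‖) := by ring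
            _ ≤ (n.choose i : ℝ) * (B * A) := mul_le_mul_of_nonneg_left h3 (Nat.cast_nonneg _)
            _ = (n.choose i : ℝ) * B * A := by ring
      _ = 2 ^ n * B * A := by
          rw [← Finset.sum_mul, ← Finset.sum_mul]
          congr 2
          have h := Nat.sum_range_choose n
          exact_mod_cast h
  · -- inside the small ball the field vanishes near `y`
    push Not at hy
    have hev : (fun y => (1 - χ y) • (f y - c)) =ᶠ[𝓝 y] fun _ => 0 := by
      filter_upwards [Metric.ball_mem_nhds y (sub_pos.2 hy)] with w hw
      have hw' : w ∈ closedBall x₀ χ.rIn := by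
        rw [mem_closedBall]
        rw [mem_ball] at hw
        linarith [dist_triangle w y x₀]
      rw [χ.one_of_mem_closedBall hw', sub_self, zero_smul]
    rw [(hev.iteratedFDeriv ℝ n).eq_of_nhds, iteratedFDeriv_fun_zero, Pi.zero_apply, norm_zero]
    positivity

/-- **Filled fields: bounds on all derivatives from exterior bounds**, packaged: for every
`n` there is `K ≥ 0` (depending only on `χ` and `n`) such that `‖∇ʲ(f − c)‖ ≤ A` for
`j ≤ n` on `r_in ≤ ‖y − x₀‖` implies `‖∇ⁿ[(1 − χ) • (f − c)](y)‖ ≤ K A` everywhere. [folklore] -/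
theorem norm_iteratedFDeriv_fill_le (n : ℕ) :
    ∃ K : ℝ, 0 ≤ K ∧ ∀ ⦃f : E → F⦄, ContDiff ℝ ∞ f → ∀ (c : F) ⦃A : ℝ⦄, 0 ≤ A →
      (∀ j, j ≤ n → ∀ y, χ.rIn ≤ dist y x₀ → ‖iteratedFDeriv ℝ j (fun y => f y - c) y‖ ≤ A) →
      ∀ y, ‖iteratedFDeriv ℝ n (fun y => (1 - χ y) • (f y - c)) y‖ ≤ K * A := by
  obtain ⟨B, hB0, hB⟩ := exists_bound_iteratedFDeriv_one_sub_bump χ n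
  exact ⟨2 ^ n * B, by positivity, fun f hf c A hA0 hA y =>
    norm_iteratedFDeriv_one_sub_bump_smul_le χ f c hB0 hB hf hA0 hA y⟩

end Fill

end Literature.Analysis.FunctionSpaces
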